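import Summits.AnomalousDissipation.AnomalousDissipation.Theorems.SolenoidalFractalHomogenisationLagrangianStepSidebandOwnSlotFrame
import Summits.AnomalousDissipation.AnomalousDissipation.Theorems.SolenoidalFractalHomogenisationLagrangianStepSidebandOwnSlotFeedback
import HarnessLib

/-!
# K1L_D `LagrangianRenormalisationStepDesign` (stmt-AnomalousDissipation-27980), registered stub `stub_D1_V0thg` (v28, ruling D28-3 (3)), port-map layer L4:
# the FROZEN-FRAME own-slot feedback formula `feedbackⱼ ∘ N^θⱼ` during slot `j` (helper; `--supports stmt-AnomalousDissipation-27980 --as helper`)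

Summits-side helper file of route `SolenoidalFractalHomogenisation` (prover seat `ad-k1l-cellLawV-w1` g9; port map
`Cruxes/LagrangianRenormalisationStepDesign/Lines/onelevel-vtheta-twist-portmap.md` §3 L4, rulings D28-7 / D28-11).  The frozen-frame twin of `…SidebandOwnSlotFeedback` §3
(§1–§2 there — `restrictScalars_exp`, `exp_restrictScalars_smul`, `continuous_exp_sub_smul_apply`, `normSq_slotAmp`, `eight_pi_sq_mul_normSq_slotAmp`, `slotAmp_cross` —
are frame-free and REUSED BY NAME).  Everything proved; no definitions, no named facts, no sorry.
* **`feedback_responseθ_eq_of_mem_slot`** — for any twisted periodic response `N` of slot `j` (`±mⱼ` retained) and `t ∈ [startⱼ, startⱼ + τⱼ]`: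
  `feedbackⱼ(t)(N t v) = (8π²|αⱼ|² envⱼ(t)) • ∫_{startⱼ}^{t} envⱼ(s) • exp((t−s)·B^θⱼ)(P^θ_{mⱼ} v) ds + 2πi envⱼ(t) • (αⱼ • exp((t−startⱼ)B^θⱼ) u₋⁰ + ᾱⱼ • exp((t−startⱼ)B^θⱼ) u₊⁰)`,
  `B^θⱼ = blockGenθ 𝔸 G₀ γ₁ mⱼ` over `ℝ`, `P^θ_{mⱼ} = transversalProjR (twistFreq G₀ mⱼ)` (`B^θ(−mⱼ) = B^θ(mⱼ)`, `P^θ_{−mⱼ} = P^θ_{mⱼ}` by `blockGenθ_neg`, `transversalProjR_neg`).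
At `G₀ = 1` this is literally `feedback_response_eq_of_mem_slot` (`blockGenθ_one`, `transversalProjR_twistFreq_one`, `isPeriodicResponseθ_one_iff`).
NOT a proof of any registered stub, of the crux, or of anomalous dissipation; rung F-D1 infrastructure for the `stub_D1_V0thg` engine (L6 `…SidebandOwnSlotLipschitz`).
-/

set_option linter.dupNamespace false

noncomputable section

namespace Summit.AnomalousDissipation.AnomalousDissipation.Theorems.SolenoidalFractalHomogenisation.LagrangianStep.Sideband

open Set MeasureTheory Complex NormedSpace intervalIntegral
open scoped InnerProductSpace
open Literature.Analysis Literature.Analysis.FunctionSpaces Literature.Analysis.FunctionSpaces.Torus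
open Literature.Analysis.FluidPDE Literature.Analysis.FluidPDE.Torus Literature.Analysis.FluidPDE.LatticeShear

variable {k₀ : ℕ}

/-! ## §1 The feedback during the slot: twisted quasi-static kernel + wrap-around -/

set_option maxHeartbeats 800000 in
/-- **`feedbackⱼ ∘ Nⱼ` DURING SLOT `j`.**  For any periodic response `N` of slot `j` (`±mⱼ` retained) and `t ∈ [startⱼ, startⱼ + τⱼ]`:
`feedbackⱼ(t)(N t v) = (8π²|αⱼ|² envⱼ(t)) • ∫_{startⱼ}^{t} envⱼ(s) • exp((t−s)·Bⱼ)(P_{mⱼ} v) ds + 2πi envⱼ(t) • (αⱼ • exp((t−startⱼ)Bⱼ) u₋⁰ + ᾱⱼ • exp((t−startⱼ)Bⱼ) u₊⁰)`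
with `u±⁰ = (N startⱼ v)_{±mⱼ}`, `Bⱼ = blockGenθθ 𝔸 G₀ γ₁ mⱼ` over `ℝ` (`8π²|αⱼ|² = 1/(2|mⱼ|²)` by `eight_pi_sq_mul_normSq_slotAmp`).
[cite: MajdaKramer1999, §2.2.1.3 (55) (effective diffusivity as a cell average)] [cite: Hale1980, Ch. III §1, Theorem 1.1] -/
theorem feedback_responseθ_eq_of_mem_slot (W₁ : LatticeWord k₀) (𝔸 : Torus.Visc4 (Fin 3)) (G₀ : Matrix (Fin 3) (Fin 3) ℝ) (γ₁ : ℝ) (R : ℕ) (j : Fin k₀)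
    {N : ℝ → (EuclideanSpace ℂ (Fin 3) →L[ℝ] Space R)} (hN : IsPeriodicResponseθ W₁ 𝔸 G₀ γ₁ R j N)
    (hm : (W₁.phase j).m ∈ box R) (hm' : -(W₁.phase j).m ∈ box R) (v : EuclideanSpace ℂ (Fin 3)) {t : ℝ}
    (ht : t ∈ Icc (W₁.start j) (W₁.start j + (W₁.phase j).τ)) :
    feedback W₁ R j t (N t v) =
      (((8 * Real.pi ^ 2 * Complex.normSq (slotAmp W₁ j) * slotEnvelope W₁ j t : ℝ) : ℂ)) •
        (∫ s in W₁.start j..t, ((slotEnvelope W₁ j s : ℝ) : ℂ) •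
          exp ((t - s) • (blockGenθ 𝔸 G₀ γ₁ (W₁.phase j).m).restrictScalars ℝ) (transversalProjR (twistFreq G₀ (W₁.phase j).m) v)) +
      (2 * Real.pi * Complex.I * ((slotEnvelope W₁ j t : ℝ) : ℂ)) •
        (slotAmp W₁ j • exp ((t - W₁.start j) • (blockGenθ 𝔸 G₀ γ₁ (W₁.phase j).m).restrictScalars ℝ) (coordL R (-(W₁.phase j).m) (N (W₁.start j) v)) +
          starRingEnd ℂ (slotAmp W₁ j) •
            exp ((t - W₁.start j) • (blockGenθ 𝔸 G₀ γ₁ (W₁.phase j).m).restrictScalars ℝ) (coordL R (W₁.phase j).m (N (W₁.start j) v))) := by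
  set m := (W₁.phase j).m with hmdef
  set Bℝ := (blockGenθ 𝔸 G₀ γ₁ m).restrictScalars ℝ with hB
  set α := slotAmp W₁ j with hα
  set env : ℝ → ℝ := slotEnvelope W₁ j with henv
  set P := transversalProjR (twistFreq G₀ m) with hP
  set t₀ := W₁.start j with ht₀
  -- the two own-fibre Duhamel formulas, with `B(−m) = B(m)` and `P_{−m} = P_m`
  have hDp := coordL_responseθ_eq_duhamel_self W₁ 𝔸 G₀ γ₁ R j hN hm v ht
  have hDn := coordL_responseθ_eq_duhamel_neg W₁ 𝔸 G₀ γ₁ R j hN hm' v ht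
  rw [blockGenθ_neg] at hDn
  simp only [twistFreq_neg, transversalProjR_neg] at hDn
  rw [feedback_apply, hDp, hDn]
  simp only [← hmdef, ← hB, ← hα, ← henv, ← hP, ← ht₀]
  -- name the three integrands (opaque local functions, to keep unification syntactic)
  have hEc : Continuous fun s : ℝ => exp ((t - s) • Bℝ) (P v) := continuous_exp_sub_smul_apply Bℝ t (P v)
  have henvc : Continuous fun s : ℝ => ((env s : ℝ) : ℂ) := Complex.continuous_ofReal.comp (continuous_slotEnvelope W₁ j)
  obtain ⟨f₁, hf₁⟩ : ∃ f : ℝ → EuclideanSpace ℂ (Fin 3), f = fun s =>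
      (-(2 * Real.pi * Complex.I * ((env s : ℝ) : ℂ) * starRingEnd ℂ α)) • exp ((t - s) • Bℝ) (P v) := ⟨_, rfl⟩
  obtain ⟨f₂, hf₂⟩ : ∃ f : ℝ → EuclideanSpace ℂ (Fin 3), f = fun s =>
      (-(2 * Real.pi * Complex.I * ((env s : ℝ) : ℂ) * α)) • exp ((t - s) • Bℝ) (P v) := ⟨_, rfl⟩
  obtain ⟨g, hg⟩ : ∃ f : ℝ → EuclideanSpace ℂ (Fin 3), f = fun s => ((env s : ℝ) : ℂ) • exp ((t - s) • Bℝ) (P v) := ⟨_, rfl⟩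
  have hc₁ : Continuous f₁ := by rw [hf₁]; exact ((continuous_const.mul henvc).mul continuous_const).neg.smul hEc
  have hc₂ : Continuous f₂ := by rw [hf₂]; exact ((continuous_const.mul henvc).mul continuous_const).neg.smul hEc
  -- pull the complex scalars through the real semigroup
  have hIp : ∫ s in t₀..t, exp ((t - s) • Bℝ) ((-(2 * Real.pi * Complex.I * ((env s : ℝ) : ℂ) * α)) • P v) = ∫ s in t₀..t, f₂ s :=
    integral_congr fun s _ => by rw [hf₂]; simp only [hB, exp_restrictScalars_smul]
  have hIn : ∫ s in t₀..t, exp ((t - s) • Bℝ) ((-(2 * Real.pi * Complex.I * ((env s : ℝ) : ℂ) * starRingEnd ℂ α)) • P v) =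
      ∫ s in t₀..t, f₁ s :=
    integral_congr fun s _ => by rw [hf₁]; simp only [hB, exp_restrictScalars_smul]
  have hG : ∫ s in t₀..t, ((env s : ℝ) : ℂ) • exp ((t - s) • Bℝ) (P v) = ∫ s in t₀..t, g s :=
    integral_congr fun s _ => by rw [hg]
  rw [hIp, hIn, hG]
  -- pointwise: `2πi env(t) · (α c₋(s) + ᾱ c₊(s)) = 8π² |α|² env(t) env(s)`
  have hpt : ∀ s, (2 * Real.pi * Complex.I * ((env t : ℝ) : ℂ)) • (α • f₁ s + starRingEnd ℂ α • f₂ s) =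
      (((8 * Real.pi ^ 2 * Complex.normSq α * env t : ℝ) : ℂ)) • g s := by
    intro s
    rw [hf₁, hf₂, hg]
    simp only [smul_smul, ← add_smul]
    congr 1
    rw [hα, slotAmp_cross W₁ j]
    push_cast
    linear_combination (-(8:ℂ) * Real.pi ^ 2 * (env t : ℂ) * (env s : ℂ) * (Complex.normSq (slotAmp W₁ j) : ℂ)) * Complex.I_mul_I
  -- integrals
  have hi₁ : IntervalIntegrable (fun s => α • f₁ s) volume t₀ t := (hc₁.const_smul α).intervalIntegrable _ _
  have hi₂ : IntervalIntegrable (fun s => starRingEnd ℂ α • f₂ s) volume t₀ t := (hc₂.const_smul (starRingEnd ℂ α)).intervalIntegrable _ _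
  have e1 : ∫ s in t₀..t, (α • f₁ s + starRingEnd ℂ α • f₂ s) = (α • ∫ s in t₀..t, f₁ s) + starRingEnd ℂ α • ∫ s in t₀..t, f₂ s := by
    rw [intervalIntegral.integral_add hi₁ hi₂, intervalIntegral.integral_smul, intervalIntegral.integral_smul]
  have e2 : ∫ s in t₀..t, (2 * Real.pi * Complex.I * ((env t : ℝ) : ℂ)) • (α • f₁ s + starRingEnd ℂ α • f₂ s) =
      (2 * Real.pi * Complex.I * ((env t : ℝ) : ℂ)) • ∫ s in t₀..t, (α • f₁ s + starRingEnd ℂ α • f₂ s) := by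
    rw [intervalIntegral.integral_smul]
  have e3 : ∫ s in t₀..t, (2 * Real.pi * Complex.I * ((env t : ℝ) : ℂ)) • (α • f₁ s + starRingEnd ℂ α • f₂ s) =
      ∫ s in t₀..t, (((8 * Real.pi ^ 2 * Complex.normSq α * env t : ℝ) : ℂ)) • g s :=
    integral_congr fun s _ => hpt s
  have e4 : ∫ s in t₀..t, (((8 * Real.pi ^ 2 * Complex.normSq α * env t : ℝ) : ℂ)) • g s =
      (((8 * Real.pi ^ 2 * Complex.normSq α * env t : ℝ) : ℂ)) • ∫ s in t₀..t, g s := by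
    rw [intervalIntegral.integral_smul]
  have key : (2 * Real.pi * Complex.I * ((env t : ℝ) : ℂ)) • ((α • ∫ s in t₀..t, f₁ s) + starRingEnd ℂ α • ∫ s in t₀..t, f₂ s) =
      (((8 * Real.pi ^ 2 * Complex.normSq α * env t : ℝ) : ℂ)) • ∫ s in t₀..t, g s := by
    rw [← e1, ← e2, e3, e4]
  -- final assembly (pure additive bookkeeping, no restatement of the large terms)
  rw [← key, ← smul_add]
  refine congrArg (fun y => (2 * Real.pi * Complex.I * ((env t : ℝ) : ℂ)) • y) ?_
  rw [smul_add, smul_add]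
  exact (add_add_add_comm _ _ _ _).trans (add_comm _ _)

end Summit.AnomalousDissipation.AnomalousDissipation.Theorems.SolenoidalFractalHomogenisation.LagrangianStep.Sideband

end
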